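import Summits.SmoothPoincare4.SmoothPoincare4.Theses.InformationMetricHadamard
import Summits.SmoothPoincare4.SmoothPoincare4.Theorems.InformationMetricHadamardConvexEndRecognitionRays

/-!
# Stub `stub_flowToRoundSphere` of line `core-distance-morse` — auxiliary file 3: a Lyapunov
# level is transverse to the field (crux `InformationMetricHadamard.C0AhRecognition`, stmt-SmoothPoincare4-6015)

Let `(W⁵, G)` be Riemannian, `f = d_G(·, K)` (`⨅ k ∈ K, G.edist · k`), `X` a vector field with
a smooth family of integral curves `θ (·, p)`, `θ (0, p) = p`, along which `f` grows at rate
`≥ δ > 0` once `f ≥ a` (`hlyap`), and `j : N → W` a smooth map into the level `{f = a}`. Then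
`X (j n) ∉ range (dj_n)`.

Proof. If `X (j n) = dj_n ζ`, consider in the chart `Φ` of `N × ℝ` at `(n, 0)` the points
`q_τ = Φ⁻¹(Φ (n, 0) + τ (-ζ, 1)) = (x_τ, τ)` and `y_τ = θ (τ, j x_τ)`. The map `(x, t) ↦ θ (t, j x)`
has differential `(w, s) ↦ dj_n w + s X (j n)` at `(n, 0)`, which kills `(-ζ, 1)`; so in the
chart `φ` of `W` at `j n`, `φ (y_τ) - φ (j n) = o(τ)`
(`HadamardConvex.tendsto_smul_comp_extChartAt_symm`), hence `d_G(j n, y_τ) = o(τ)` (charts are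
locally Lipschitz for `d_G`, Mathlib's `eventually_riemannianEDist_le_edist_extChartAt`). But
`f (y_τ) ≥ f (j x_τ) + δ τ = a + δ τ` while `f` is `1`-Lipschitz: `f (y_τ) ≤ a + d_G(j n, y_τ)`;
contradiction for small `τ > 0`.

* `FlowToRoundSphere.mfderiv_flowComp_apply` — the differential of `(x, t) ↦ θ (t, j x)` at `t = 0`;
* `helper_flowToRoundSphere_3` — the registered helper (transversality).

Everything is proved (kind = proof); no definitions.
-/

noncomputable section

-- the prescribed namespace `Summit.<P>.<Sub>.…` duplicates `SmoothPoincare4` (P = Sub)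
set_option linter.dupNamespace false

open scoped Manifold ContDiff Topology ENNReal NNReal
open Set Function Bundle Filter Manifold

namespace Summit.SmoothPoincare4.SmoothPoincare4.Cruxes.C0AhRecognition.CoreDistanceMorse

open Literature.Geometry.Lorentzian Literature.Geometry.Lorentzian.PseudoRiemannianMetric
  Literature.Geometry.Riemannian
  Summit.SmoothPoincare4.SmoothPoincare4.Theorems

namespace FlowToRoundSphere

variable {W : Type} [TopologicalSpace W] [ChartedSpace (EuclideanSpace ℝ (Fin 5)) W]
  [IsManifold (𝓡 5) ∞ W]
  {N : Type} [TopologicalSpace N] [ChartedSpace (EuclideanSpace ℝ (Fin 4)) N]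
  [IsManifold (𝓡 4) ∞ N]

omit [IsManifold (𝓡 5) ∞ W] [IsManifold (𝓡 4) ∞ N] in
/-- **Differential of the flow-out of a map.** For a smooth family `θ` of integral curves of `X`
with `θ (0, p) = p` and a smooth `j : N → W`, the map `A (x, t) = θ (t, j x)` has
`dA_{(n,0)} (w, s) = dj_n w + s X (j n)`. [folklore] -/
theorem mfderiv_flowComp_apply {X : Π y : W, TangentSpace (𝓡 5) y} {θ : ℝ × W → W}
    (hθ : ContMDiff (𝓘(ℝ, ℝ).prod (𝓡 5)) (𝓡 5) ∞ θ) (h0 : ∀ p : W, θ (0, p) = p)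
    (hcurve : ∀ p : W, IsMIntegralCurve (fun t : ℝ ↦ θ (t, p)) X) {j : N → W}
    (hj : ContMDiff (𝓡 4) (𝓡 5) ∞ j) (n : N) (w : TangentSpace (𝓡 4) n) (s : ℝ) :
    mfderiv ((𝓡 4).prod 𝓘(ℝ, ℝ)) (𝓡 5) (fun q : N × ℝ ↦ θ (q.2, j q.1)) (n, 0)
        ((w, s) : TangentSpace ((𝓡 4).prod 𝓘(ℝ, ℝ)) (n, (0 : ℝ))) =
      mfderiv (𝓡 4) (𝓡 5) j n w + s • X (j n) := by
  have hA : ContMDiff ((𝓡 4).prod 𝓘(ℝ, ℝ)) (𝓡 5) ∞ (fun q : N × ℝ ↦ θ (q.2, j q.1)) :=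
    hθ.comp (contMDiff_snd.prodMk (hj.comp contMDiff_fst))
  rw [mfderiv_prod_eq_add_apply (hA.mdifferentiableAt (by simp))]
  show mfderiv (𝓡 4) (𝓡 5) (fun z : N ↦ θ (0, j z)) n w +
      mfderiv 𝓘(ℝ, ℝ) (𝓡 5) (fun t : ℝ ↦ θ (t, j n)) 0 s = mfderiv (𝓡 4) (𝓡 5) j n w + s • X (j n)
  have hA1 : (fun z : N ↦ θ (0, j z)) = j := funext fun z ↦ h0 (j z)
  have h1 : (mfderiv (𝓡 4) (𝓡 5) (fun z : N ↦ θ (0, j z)) n w : EuclideanSpace ℝ (Fin 5)) =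
      mfderiv (𝓡 4) (𝓡 5) j n w :=
    congrArg (fun g : N → W ↦ (mfderiv (𝓡 4) (𝓡 5) g n w : EuclideanSpace ℝ (Fin 5))) hA1
  have h2 : (mfderiv 𝓘(ℝ, ℝ) (𝓡 5) (fun t : ℝ ↦ θ (t, j n)) 0 s : EuclideanSpace ℝ (Fin 5)) =
      s • X (j n) := by
    rw [(hcurve (j n) 0).mfderiv]
    show (s : ℝ) • (X (θ (0, j n)) : EuclideanSpace ℝ (Fin 5)) = s • X (j n)
    rw [h0]
  rw [h1, h2]
  rfl

end FlowToRoundSphere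

open FlowToRoundSphere in
/-- **Helper 3 for stub E3 (`flowToRoundSphere`): a Lyapunov level is transverse to the field.**
See the module docstring: if `f = d_G(·, K)` grows at rate `≥ δ > 0` along the integral curves
`θ (·, p)` of `X` started in `{f ≥ a}`, and `j : N → W` is smooth with `f ∘ j = a`, then
`X (j n)` is not tangent to `j` at `n`. [cite: LeeSmoothManifolds2013, Thm. 9.12] -/
theorem helper_flowToRoundSphere_3
    (W : Type) [TopologicalSpace W] [T2Space W]
    [ChartedSpace (EuclideanSpace ℝ (Fin 5)) W] [IsManifold (𝓡 5) ∞ W]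
    (G : PseudoRiemannianMetric (𝓡 5) ∞ (EuclideanSpace ℝ (Fin 5)) (TangentSpace (𝓡 5) : W → Type _))
    (hG : G.IsRiemannian) (K : Set W) (a : ℝ)
    (X : Π y : W, TangentSpace (𝓡 5) y) (δ : ℝ) (hδ : 0 < δ)
    (hlyap : ∀ (γ : ℝ → W) (t₁ t₂ : ℝ), t₁ ≤ t₂ → IsMIntegralCurveOn γ X (Icc t₁ t₂) →
      ENNReal.ofReal a ≤ ⨅ k ∈ K, G.edist hG (γ t₁) k →
      (⨅ k ∈ K, G.edist hG (γ t₁) k) + ENNReal.ofReal (δ * (t₂ - t₁)) ≤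
        ⨅ k ∈ K, G.edist hG (γ t₂) k)
    (θ : ℝ × W → W) (hθ : ContMDiff (𝓘(ℝ, ℝ).prod (𝓡 5)) (𝓡 5) ∞ θ)
    (h0 : ∀ p : W, θ (0, p) = p)
    (hcurve : ∀ p : W, IsMIntegralCurve (fun t : ℝ ↦ θ (t, p)) X)
    (N : Type) [TopologicalSpace N] [ChartedSpace (EuclideanSpace ℝ (Fin 4)) N]
    [IsManifold (𝓡 4) ∞ N]
    (j : N → W) (hj : ContMDiff (𝓡 4) (𝓡 5) ∞ j)
    (hja : ∀ x : N, ⨅ k ∈ K, G.edist hG (j x) k = ENNReal.ofReal a) (n : N) :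
    X (j n) ∉ range (mfderiv (𝓡 4) (𝓡 5) j n) := by
  -- the Riemannian distance as an extended metric on `W`
  letI := G.riemannianBundle hG
  haveI := G.isContinuousRiemannianBundle hG
  haveI : LocallyCompactSpace W := ChartedSpace.locallyCompactSpace (EuclideanSpace ℝ (Fin 5)) W
  letI : PseudoEMetricSpace W := .ofRiemannianMetric (𝓡 5) W
  set f : W → ℝ≥0∞ := fun y ↦ ⨅ k ∈ K, G.edist hG y k with hf
  have hfE : ∀ y : W, f y = Metric.infEDist y K := fun _ ↦ rfl
  have hflip : ∀ y y' : W, f y ≤ f y' + G.edist hG y y' := fun y y' ↦ by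
    rw [hfE, hfE]
    exact Metric.infEDist_le_infEDist_add_edist
  rintro ⟨ζ, hζ⟩
  set x₀ : W := j n with hx₀
  -- the chart of `W` at `x₀` is Lipschitz for `d_G` near `x₀`
  obtain ⟨C, hC, hLip⟩ := eventually_riemannianEDist_le_edist_extChartAt (𝓡 5) x₀
  set φ := extChartAt (𝓡 5) x₀ with hφ
  -- the flow-out `A (x, t) = θ (t, j x)` and its chart expression `Gm = φ ∘ A - φ x₀`
  set A : N × ℝ → W := fun q ↦ θ (q.2, j q.1) with hA
  have hAs : ContMDiff ((𝓡 4).prod 𝓘(ℝ, ℝ)) (𝓡 5) ∞ A :=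
    hθ.comp (contMDiff_snd.prodMk (hj.comp contMDiff_fst))
  have hA0 : A (n, 0) = x₀ := h0 _
  set ξ : EuclideanSpace ℝ (Fin 4) × ℝ := (-ζ, 1) with hξ
  have hdA : mfderiv ((𝓡 4).prod 𝓘(ℝ, ℝ)) (𝓡 5) A (n, 0) ξ = 0 := by
    have h := mfderiv_flowComp_apply hθ h0 hcurve hj n (-ζ) 1
    rw [map_neg, one_smul] at h
    rw [show (mfderiv (𝓡 4) (𝓡 5) j n) ζ = X (j n) from hζ, neg_add_cancel] at h
    exact h
  set Gm : N × ℝ → EuclideanSpace ℝ (Fin 5) := (φ ∘ A) - fun _ ↦ φ x₀ with hGm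
  obtain ⟨Lφ, hφd⟩ : ∃ Lφ : EuclideanSpace ℝ (Fin 5) →L[ℝ] EuclideanSpace ℝ (Fin 5),
      HasMFDerivAt (𝓡 5) 𝓘(ℝ, EuclideanSpace ℝ (Fin 5)) φ (A (n, 0)) Lφ := by
    rw [hA0]
    exact ⟨_, hasMFDerivAt_extChartAt (mem_chart_source _ x₀)⟩
  obtain ⟨LA, hAd, hLA⟩ : ∃ LA : (EuclideanSpace ℝ (Fin 4) × ℝ) →L[ℝ] EuclideanSpace ℝ (Fin 5),
      HasMFDerivAt ((𝓡 4).prod 𝓘(ℝ, ℝ)) (𝓡 5) A (n, 0) LA ∧ LA ξ = 0 :=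
    ⟨_, (hAs.mdifferentiableAt (by simp)).hasMFDerivAt, hdA⟩
  have hGmd : HasMFDerivAt ((𝓡 4).prod 𝓘(ℝ, ℝ)) 𝓘(ℝ, EuclideanSpace ℝ (Fin 5)) Gm (n, 0)
      (Lφ.comp LA - 0 : (EuclideanSpace ℝ (Fin 4) × ℝ) →L[ℝ] EuclideanSpace ℝ (Fin 5)) :=
    (HasMFDerivAt.comp (n, (0 : ℝ)) hφd hAd).sub (hasMFDerivAt_const _ _)
  have hGm0 : Gm (n, 0) = 0 := by
    show φ (A (n, 0)) - φ x₀ = 0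
    rw [hA0, sub_self]
  have hdG : mfderiv ((𝓡 4).prod 𝓘(ℝ, ℝ)) 𝓘(ℝ, EuclideanSpace ℝ (Fin 5)) Gm (n, 0) ξ = 0 := by
    rw [hGmd.mfderiv, sub_zero]
    show Lφ (LA ξ) = 0
    rw [hLA, map_zero]
  -- first-order expansion along the chart line through `(n, 0)` in direction `ξ`
  have hT := HadamardConvex.tendsto_smul_comp_extChartAt_symm hGmd.mdifferentiableAt hGm0 ξ
  rw [hdG] at hT
  set Φ := extChartAt ((𝓡 4).prod 𝓘(ℝ, ℝ)) ((n, (0 : ℝ)) : N × ℝ) with hΦ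
  set q : ℝ → N × ℝ := fun τ ↦ Φ.symm (Φ (n, 0) + τ • ξ) with hq
  have hq2 : ∀ τ : ℝ, (q τ).2 = τ := fun τ ↦ by
    show (Φ.symm (Φ (n, 0) + τ • ξ)).2 = τ
    rw [hΦ, hξ, extChartAt_prod]
    simp [PartialEquiv.prod_coe]
  have hq0 : q 0 = (n, 0) := by
    simp only [hq, zero_smul, add_zero]
    exact Φ.left_inv (mem_extChartAt_source _)
  -- `y τ = A (q τ) = θ (τ, j x_τ)` tends to `x₀`
  have hqc : Tendsto q (𝓝 0) (𝓝 (n, 0)) := by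
    have h1 : ContinuousAt Φ.symm (Φ (n, 0)) := continuousAt_extChartAt_symm _
    have h2 : Tendsto (fun τ : ℝ ↦ Φ (n, 0) + τ • ξ) (𝓝 0) (𝓝 (Φ (n, 0))) := by
      have : Continuous fun τ : ℝ ↦ Φ (n, 0) + τ • ξ := by fun_prop
      simpa using this.tendsto 0
    have h3 : Tendsto q (𝓝 0) (𝓝 (Φ.symm (Φ (n, 0)))) := h1.tendsto.comp h2
    have hΦ0 : Φ.symm (Φ (n, 0)) = (n, 0) := Φ.left_inv (mem_extChartAt_source _)
    rw [hΦ0] at h3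
    exact h3
  have hyc : Tendsto (fun τ ↦ A (q τ)) (𝓝 0) (𝓝 x₀) := by
    rw [← hA0]
    exact (hAs.continuous.tendsto _).comp hqc
  -- the three eventualities, at a common small `τ > 0`
  set c : ℝ := (C : ℝ) with hc
  have hc0 : 0 < c := by exact_mod_cast hC
  set ε : ℝ := δ / (2 * c) with hε
  have hε0 : 0 < ε := div_pos hδ (by positivity)
  have hev1 : ∀ᶠ τ in 𝓝[≠] (0 : ℝ), ‖τ⁻¹ • Gm (q τ)‖ < ε :=
    (NormedAddGroup.tendsto_nhds_zero.1 hT) ε hε0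
  have hev2 : ∀ᶠ τ in 𝓝 (0 : ℝ), riemannianEDist (𝓡 5) x₀ (A (q τ)) ≤
      C * edist (φ x₀) (φ (A (q τ))) := hyc.eventually hLip
  have hev3 : ∀ᶠ τ in 𝓝[>] (0 : ℝ), τ ∈ Ioi (0 : ℝ) := eventually_mem_nhdsWithin
  obtain ⟨τ, h1, h2, hτ⟩ := ((hev1.filter_mono (nhdsGT_le_nhdsNE 0)).and
    ((hev2.filter_mono nhdsWithin_le_nhds).and hev3)).exists
  have hτ0 : 0 < τ := hτ
  -- the chart distance is small
  have hnorm : ‖φ (A (q τ)) - φ x₀‖ < ε * τ := by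
    have h : ‖τ⁻¹ • Gm (q τ)‖ = τ⁻¹ * ‖φ (A (q τ)) - φ x₀‖ := by
      rw [norm_smul, norm_inv, Real.norm_eq_abs, abs_of_pos hτ0]
      rfl
    rw [h, inv_mul_lt_iff₀ hτ0] at h1
    linarith [mul_comm ε τ]
  -- hence the Riemannian distance is small
  have hdist : G.edist hG x₀ (A (q τ)) ≤ ENNReal.ofReal (δ * τ / 2) := by
    have h : G.edist hG x₀ (A (q τ)) ≤ C * edist (φ x₀) (φ (A (q τ))) := h2
    refine h.trans ?_
    rw [edist_dist, dist_eq_norm, norm_sub_rev, ← ENNReal.ofReal_coe_nnreal,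
      ← ENNReal.ofReal_mul NNReal.zero_le_coe]
    refine ENNReal.ofReal_le_ofReal ?_
    calc (C : ℝ) * ‖φ (A (q τ)) - φ x₀‖ ≤ c * (ε * τ) :=
          mul_le_mul_of_nonneg_left hnorm.le hc0.le
      _ = δ * τ / 2 := by rw [hε]; field_simp
  -- the level value at the foot `j x_τ` and the Lyapunov growth up to `y τ = θ (τ, j x_τ)`
  have hyτ : A (q τ) = θ (τ, j (q τ).1) := by
    show θ ((q τ).2, j (q τ).1) = θ (τ, j (q τ).1)
    rw [hq2]
  have hgrow : ENNReal.ofReal a + ENNReal.ofReal (δ * τ) ≤ f (A (q τ)) := by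
    have hja' : f (j (q τ).1) = ENNReal.ofReal a := hja _
    have h := hlyap (fun s : ℝ ↦ θ (s, j (q τ).1)) 0 τ hτ0.le
      ((hcurve _).isMIntegralCurveOn _) (by
        show ENNReal.ofReal a ≤ f (θ (0, j (q τ).1))
        rw [h0, hja'])
    have h' : f (θ (0, j (q τ).1)) + ENNReal.ofReal (δ * (τ - 0)) ≤ f (θ (τ, j (q τ).1)) := h
    rw [h0, hja', sub_zero] at h'
    rwa [hyτ]
  -- the Lipschitz bound of `f`
  have hup : f (A (q τ)) ≤ ENNReal.ofReal a + ENNReal.ofReal (δ * τ / 2) := by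
    have h := hflip (A (q τ)) x₀
    rw [show f x₀ = ENNReal.ofReal a from hja n, G.edist_comm hG] at h
    exact h.trans (add_le_add le_rfl hdist)
  have hfin := (ENNReal.add_le_add_iff_left ENNReal.ofReal_ne_top).1 (hgrow.trans hup)
  rw [ENNReal.ofReal_le_ofReal_iff (by positivity)] at hfin
  nlinarith [mul_pos hδ hτ0]

end Summit.SmoothPoincare4.SmoothPoincare4.Cruxes.C0AhRecognition.CoreDistanceMorse

end
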